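import Mathlib

/-!
# Phase-blind Schur envelope: a modulus envelope of the loop kernel bounds the bridge resolvent (solo-blind kernel #175)

Paper `steady-zeroth-law.md` §24.103 (f) / PLAN §103 (f).  On the bridge range `P ∈ [P_B1, P_fr]` the structured
resolvent of the leaf monodromy is reduced (kernels #171–#174) to the scalar loop operator `1 + 𝒦(P)` of the
decoupled Kelvin-mode hierarchy — an integral operator whose kernel `k(t,s;P)` has a `P`-oscillating PHASE but a
tame MODULUS: the computed Schur mass `√(max-row-L¹ · max-col-L¹)` of `|k|` is `.43 … .24` for `P = 300 … 600`
(D51), although `sup |k| ≈ 1.6`.  The bridge certificate therefore needs only a pointwise envelope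
`|k(t,s;P)| ≤ E(t,s)` with row sums `≤ r`, column sums `≤ c` and `r c < 1`, uniformly in `P`, together with the
following finite-dimensional (Nyström / Galerkin level) facts, proved here for an arbitrary matrix over `ℝ` or `ℂ`
dominated entrywise by a nonnegative real matrix `E`:

* `schurEnv_weighted_cs` — weighted Cauchy–Schwarz `(∑ E_j a_j)² ≤ (∑ E_j) (∑ E_j a_j²)` for `E ≥ 0`;
* `schurEnv_row_sq` — one row: `‖∑_j A_ij x_j‖² ≤ (∑_j E_ij) ∑_j E_ij ‖x_j‖²`;
* `schurEnv_schur_test` — the Schur test in sum form, `∑_i ‖(A x)_i‖² ≤ r c ∑_j ‖x_j‖²` — PHASE-BLIND: only the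
  envelope `E` enters, so one envelope serves every `P` it dominates;
* `schurEnv_apriori` — the resolvent a-priori bound `‖x‖₂ ≤ (1 - √(r c))⁻¹ ‖(1 + A) x‖₂` for `r c < 1`;
* `schurEnv_isUnit` — hence `1 + A` is invertible.
-/

namespace Summit.AnomalousDissipation.AnomalousDissipation.Theorems

open Finset Matrix WithLp

section

variable {ι : Type*}

/-- Weighted Cauchy–Schwarz (Jensen for the weights `E`): for `E_j ≥ 0`,
`(∑ E_j a_j)² ≤ (∑ E_j) · ∑ E_j a_j²`. -/
theorem schurEnv_weighted_cs (s : Finset ι) (E a : ι → ℝ) (hE : ∀ j ∈ s, 0 ≤ E j) :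
    (∑ j ∈ s, E j * a j) ^ 2 ≤ (∑ j ∈ s, E j) * ∑ j ∈ s, E j * a j ^ 2 :=
  sum_sq_le_sum_mul_sum_of_sq_le_mul s hE (fun j hj => mul_nonneg (hE j hj) (sq_nonneg _))
    (fun j _ => by ring_nf; exact le_rfl)

variable [Fintype ι] [DecidableEq ι] {𝕜 : Type*} [RCLike 𝕜]

omit [DecidableEq ι] in
/-- One row of the Schur test: if `‖A_ij‖ ≤ E_ij` then `‖∑_j A_ij x_j‖² ≤ (∑_j E_ij) · ∑_j E_ij ‖x_j‖²`. -/
theorem schurEnv_row_sq (a : ι → 𝕜) (e : ι → ℝ) (hae : ∀ j, ‖a j‖ ≤ e j) (x : ι → 𝕜) :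
    ‖∑ j, a j * x j‖ ^ 2 ≤ (∑ j, e j) * ∑ j, e j * ‖x j‖ ^ 2 := by
  have he : ∀ j ∈ (univ : Finset ι), 0 ≤ e j := fun j _ => (norm_nonneg _).trans (hae j)
  have h1 : ‖∑ j, a j * x j‖ ≤ ∑ j, e j * ‖x j‖ := by
    refine (norm_sum_le _ _).trans (sum_le_sum fun j _ => ?_)
    rw [norm_mul]
    exact mul_le_mul_of_nonneg_right (hae j) (norm_nonneg _)
  calc ‖∑ j, a j * x j‖ ^ 2 ≤ (∑ j, e j * ‖x j‖) ^ 2 := pow_le_pow_left₀ (norm_nonneg _) h1 2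
    _ ≤ (∑ j, e j) * ∑ j, e j * ‖x j‖ ^ 2 := schurEnv_weighted_cs univ e (fun j => ‖x j‖) he

omit [DecidableEq ι] in
/-- **Schur test, phase-blind sum form.**  If `‖A_ij‖ ≤ E_ij`, the row sums of `E` are `≤ r` (`r ≥ 0`) and the
column sums are `≤ c`, then `∑_i ‖(A x)_i‖² ≤ r c ∑_j ‖x_j‖²`, i.e. `‖A‖_{ℓ² → ℓ²} ≤ √(r c)`. -/
theorem schurEnv_schur_test (A : Matrix ι ι 𝕜) (E : Matrix ι ι ℝ) (r c : ℝ) (hr : 0 ≤ r)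
    (hAE : ∀ i j, ‖A i j‖ ≤ E i j) (hrow : ∀ i, ∑ j, E i j ≤ r) (hcol : ∀ j, ∑ i, E i j ≤ c)
    (x : ι → 𝕜) : ∑ i, ‖(A *ᵥ x) i‖ ^ 2 ≤ r * c * ∑ j, ‖x j‖ ^ 2 := by
  have hE : ∀ i j, 0 ≤ E i j := fun i j => (norm_nonneg _).trans (hAE i j)
  calc ∑ i, ‖(A *ᵥ x) i‖ ^ 2 ≤ ∑ i, (∑ j, E i j) * ∑ j, E i j * ‖x j‖ ^ 2 :=
        sum_le_sum fun i _ => schurEnv_row_sq (A i) (E i) (hAE i) x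
    _ ≤ ∑ i, r * ∑ j, E i j * ‖x j‖ ^ 2 := by
        refine sum_le_sum fun i _ => mul_le_mul_of_nonneg_right (hrow i) ?_
        exact sum_nonneg fun j _ => mul_nonneg (hE i j) (sq_nonneg _)
    _ = r * ∑ j, (∑ i, E i j) * ‖x j‖ ^ 2 := by
        rw [← mul_sum, sum_comm]
        congr 1
        exact sum_congr rfl fun j _ => by rw [sum_mul]
    _ ≤ r * ∑ j, c * ‖x j‖ ^ 2 := by
        refine mul_le_mul_of_nonneg_left (sum_le_sum fun j _ => ?_) hr
        exact mul_le_mul_of_nonneg_right (hcol j) (sq_nonneg _)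
    _ = r * c * ∑ j, ‖x j‖ ^ 2 := by rw [← mul_sum, mul_assoc]

/-- The Schur test as an `ℓ²`-norm bound on `EuclideanSpace`: `‖A x‖₂ ≤ √(r c) ‖x‖₂`. -/
theorem schurEnv_norm_le (A : Matrix ι ι 𝕜) (E : Matrix ι ι ℝ) (r c : ℝ) (hr : 0 ≤ r) (hc : 0 ≤ c)
    (hAE : ∀ i j, ‖A i j‖ ≤ E i j) (hrow : ∀ i, ∑ j, E i j ≤ r) (hcol : ∀ j, ∑ i, E i j ≤ c)
    (x : EuclideanSpace 𝕜 ι) : ‖toEuclideanLin A x‖ ≤ Real.sqrt (r * c) * ‖x‖ := by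
  have hrc : 0 ≤ r * c := mul_nonneg hr hc
  have h2 : ‖toEuclideanLin A x‖ ^ 2 ≤ (Real.sqrt (r * c) * ‖x‖) ^ 2 := by
    rw [mul_pow, Real.sq_sqrt hrc, EuclideanSpace.norm_sq_eq, EuclideanSpace.norm_sq_eq,
      toLpLin_apply]
    simpa [PiLp.toLp_apply] using schurEnv_schur_test A E r c hr hAE hrow hcol (ofLp x)
  exact (pow_le_pow_iff_left₀ (norm_nonneg _) (by positivity) two_ne_zero).mp h2

/-- **Phase-blind resolvent a-priori bound.**  Under the envelope hypotheses with `r c < 1`: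
`‖x‖₂ ≤ (1 - √(r c))⁻¹ ‖x + A x‖₂` for every `x`. -/
theorem schurEnv_apriori (A : Matrix ι ι 𝕜) (E : Matrix ι ι ℝ) (r c : ℝ) (hr : 0 ≤ r) (hc : 0 ≤ c)
    (hrc : r * c < 1)
    (hAE : ∀ i j, ‖A i j‖ ≤ E i j) (hrow : ∀ i, ∑ j, E i j ≤ r) (hcol : ∀ j, ∑ i, E i j ≤ c)
    (x : EuclideanSpace 𝕜 ι) :
    ‖x‖ ≤ (1 - Real.sqrt (r * c))⁻¹ * ‖x + toEuclideanLin A x‖ := by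
  set q := Real.sqrt (r * c) with hq
  have hq1 : q < 1 := by
    rw [hq, ← Real.sqrt_one]
    exact Real.sqrt_lt_sqrt (mul_nonneg hr hc) hrc
  have hKx : ‖toEuclideanLin A x‖ ≤ q * ‖x‖ := schurEnv_norm_le A E r c hr hc hAE hrow hcol x
  have htri : ‖x‖ ≤ ‖x + toEuclideanLin A x‖ + ‖toEuclideanLin A x‖ := by
    have := norm_sub_le (x + toEuclideanLin A x) (toEuclideanLin A x)
    simpa using this
  have h1q : 0 < 1 - q := by linarith
  rw [le_inv_mul_iff₀ h1q]
  nlinarith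

/-- The same bound written on plain vectors: `√(∑ ‖x_i‖²) ≤ (1 - √(r c))⁻¹ √(∑ ‖x_i + ∑_j A_ij x_j‖²)`. -/
theorem schurEnv_apriori_sum (A : Matrix ι ι 𝕜) (E : Matrix ι ι ℝ) (r c : ℝ) (hr : 0 ≤ r) (hc : 0 ≤ c)
    (hrc : r * c < 1)
    (hAE : ∀ i j, ‖A i j‖ ≤ E i j) (hrow : ∀ i, ∑ j, E i j ≤ r) (hcol : ∀ j, ∑ i, E i j ≤ c)
    (x : ι → 𝕜) :
    Real.sqrt (∑ i, ‖x i‖ ^ 2) ≤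
      (1 - Real.sqrt (r * c))⁻¹ * Real.sqrt (∑ i, ‖x i + ∑ j, A i j * x j‖ ^ 2) := by
  have h := schurEnv_apriori A E r c hr hc hrc hAE hrow hcol (toLp 2 x)
  rw [EuclideanSpace.norm_eq, EuclideanSpace.norm_eq, toLpLin_apply] at h
  simpa [PiLp.toLp_apply, mulVec, dotProduct] using h

/-- **Invertibility.**  Under the envelope hypotheses with `r c < 1`, `1 + A` is invertible. -/
theorem schurEnv_isUnit (A : Matrix ι ι 𝕜) (E : Matrix ι ι ℝ) (r c : ℝ) (hr : 0 ≤ r)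
    (hc : 0 ≤ c) (hrc : r * c < 1)
    (hAE : ∀ i j, ‖A i j‖ ≤ E i j) (hrow : ∀ i, ∑ j, E i j ≤ r) (hcol : ∀ j, ∑ i, E i j ≤ c) :
    IsUnit (1 + A) := by
  rw [← mulVec_injective_iff_isUnit]
  intro x y hxy
  have h0 : (1 + A) *ᵥ (x - y) = 0 := by rw [mulVec_sub, hxy, sub_self]
  have h := schurEnv_apriori A E r c hr hc hrc hAE hrow hcol (toLp 2 (x - y))
  have hzero : toLp 2 (x - y) + toEuclideanLin A (toLp 2 (x - y)) = (0 : EuclideanSpace 𝕜 ι) := by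
    rw [toLpLin_apply, ← toLp_add, ← toLp_zero 2]
    congr 1
    rw [add_mulVec, one_mulVec] at h0
    simpa using h0
  rw [hzero, norm_zero, mul_zero] at h
  have hxy0 : toLp 2 (x - y) = (0 : EuclideanSpace 𝕜 ι) := norm_le_zero_iff.mp h
  have : x - y = 0 := by
    have := congrArg ofLp hxy0
    simpa using this
  exact sub_eq_zero.mp this

end

end Summit.AnomalousDissipation.AnomalousDissipation.Theorems
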